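import Mathlib.Analysis.Fourier.AddCircle
import Mathlib.MeasureTheory.Measure.Haar.Unique
import Mathlib.MeasureTheory.Function.Holder
import Mathlib.Analysis.InnerProductSpace.Positive
import Mathlib.Analysis.SpecialFunctions.Pow.Complex
import Literature.Analysis.UnboundedOperators.DiagonalOperatorProofs
import Literature.Analysis.InnerProduct.CourantFischerBounds
import Literature.Barriers.RiemannHypothesis.BerryKeatingOperatorProofs
import HarnessLib

/-!
# Connes–Consani, *Spectral triples and ζ-cycles*, §4–§5: the spectral triple `Θ(λ,k)` and its eigenvalues

LABEL (line 1): **RH-FREE corpus literature.** This file types §4 ("The spectral triple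
`Θ(λ,k) = (𝒜(λ), ℋ(λ), D(λ,k))`") and §5 ("Zeta zeros from eigenvalues of spectral triples") of
A. Connes, C. Consani, *Spectral triples and ζ-cycles*, Enseign. Math. 69 (2023) 93–148,
doi:10.4171/lem/1049 = arXiv:2106.01715 [cite: ConnesConsani2023, §4–§5]. Locators `(arXiv chunk
pNNNN:Lnn)` refer to the materialised text `paper:arxiv-2106.01715` (22 chunks). Nothing in this
file is a positivity statement, nothing is RH-equivalent, and nothing here bears on the truth of RH:
§4–§5 study finite-rank perturbations of `−i d/dx` on a circle whose low spectrum is *numerically*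
compared with zeta zeros; the numerical tables (§4.1–§4.2, §5.1–§5.4 figures) are NOT typed.

## What is printed, and how it is typed

* §4 (p0013:L3–L13). `𝒜(λ) := C^∞(ℝ₊^*/λ^{2ℤ})` acting by multiplication on
  `ℋ(λ) := L²(ℝ₊^*/λ^{2ℤ}, d^*u)`; `D(λ,k) := (1 − Π(λ,k)) ∘ D₀(λ) ∘ (1 − Π(λ,k))`,
  `D₀(λ) := −iu∂_u` (eq. (4.1)); "a finite rank perturbation of the standard Dirac operator … the range
  of the prolate projection `Π(λ,k)` is contained in the domain of `D₀(λ)`", and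
  `D(λ,k) = D₀ − ΠD₀ − D₀Π + ΠD₀Π`. Under `u = e^x` the quotient `ℝ₊^*/λ^{2ℤ}` with `d^*u = du/u` is
  the circle `ℝ/Lℤ` of length `L = 2 log λ = log μ` (`μ = λ²`; §2 p0005 "the length `L = 2 log λ`",
  p0013:L43 "using `L = log μ`") with `dx`, and `−iu∂_u = −i∂_x`; Prop. 4.1 itself is phrased on
  "periodic functions … in `L²([−L/2, L/2])`". TYPED on Mathlib's `AddCircle L` with its Haar
  probability measure (`haarAddCircle`, a constant multiple of `dx`, immaterial for spectra):
  `circleL2 L = Lp ℂ 2 haarAddCircle`; `D₀` is the maximal diagonal operator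
  `fourierBasis.diagonalPMap (2πj/L)_j` of the tree's UnboundedOperators prelude
  (`HilbertBasis.diagonalPMap`) — i.e. `−i d/dx` on its natural (Sobolev `H¹`) domain, since
  `−i (e^{2πijx/L})′ = (2πj/L) e^{2πijx/L}` (`neg_I_mul_deriv_fourier`, from Mathlib's
  `hasDerivAt_fourier`) and `D₀ e_j = (2πj/L) e_j` (`diracD0_apply_fourierLp`); it is self-adjoint
  (`isSelfAdjoint_diracD0`, from `HilbertBasis.isSelfAdjoint_diagonalPMap_holds`), its eigenvalues are
  exactly `{2πj/L : j ∈ ℤ}` (`hasEigenvalue_diracD0_iff`; printed p0013:L37 "the spectrum of `D₀(λ)` of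
  `{2πk/L ∣ k ∈ ℤ}`") and its kernel is the constants (`mem_kernel_diracD0_iff`; printed p0016:L33 "The
  kernel of the operator `D₀(λ)` is one dimensional and given by the constant function `1_λ` which is
  even").
* The prolate projection `Π(λ,k)` (Def. 3.1, p0012:L26: "the orthogonal projection on the linear span
  of the vectors `ε_n`, `n ∈ {2,…,k+1}`", the `ε_n ∈ E_N ⊂ ℋ` being Gram–Schmidt vectors built
  numerically from prolate spheroidal data, p0012:L7–L24) belongs to §3 (typer t9). Here it is
  PARAMETERISED: `Π = U.starProjection` for an arbitrary finite-dimensional subspace `U ≤ dom D₀`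
  (the printed `U = span{ε_2,…,ε_{k+1}} ⊂ E_N`, trigonometric polynomials, is such a subspace), and the
  commutation (3.3) `γ Π(λ,k) = Π(λ,k) γ` (p0012:L31) enters as an explicit hypothesis where used. The
  grading `γ` (p0012:L28: `±1` on `f(u⁻¹) = ±f(u)`) is `circleGrading L : f ↦ f(−x)`, a linear isometric
  involution with `γ e_j = e_{−j}` and `D₀ γ = −γ D₀` (`diracD0_circleGrading`).
* `D(λ,k)` is `diracD L U hU : circleL2 L →ₗ.[ℂ] circleL2 L`, domain `dom D₀`. PROVED: the printed
  expansion (`diracD_apply_eq_expand`), "the kernel of `D(λ,k)` contains the range of `Π(λ,k)`"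
  (p0016:L27; `le_kernel_diracD`), symmetry (`isSymmetric_diracD`), eq. (5.1) `γ D(λ,k) = −D(λ,k) γ`
  under (3.3) (p0016:L29; `diracD_circleGrading`, hence `t ↦ −t` symmetry of eigenvalues
  `diracD_circleGrading_of_eigen`, used in the proof of Prop. 4.2 p0013:L37), and the mechanism behind
  §5.3–§5.4 and §6: an eigenvector of `D₀` orthogonal to `range Π` is an eigenvector of `D(λ,k)` with the
  SAME eigenvalue (`diracD_apply_of_mem_orthogonal`).
* **Proposition 4.1** (p0013:L15): "The operator `D(λ,k)`, combined with the action of periodic functions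
  by multiplication in `L²([−L/2,L/2])` defines a spectral triple" (proof p0013:L17: finite rank
  perturbation, Kato–Rellich [Schmüdgen, Prop. 8.6], bounded commutators). TYPED AS A NAMED FACT
  `ConnesConsani2023_prop_4_1` (unproved here) over the minimal explicit data — no spectral-triple
  class: `smoothCircleAlgebra L` (`= C^∞(S¹_L)`: continuous maps whose lift to `ℝ` is `C^∞`), its action
  `mulCLM a` on `L²` (Hölder `L^∞·L² ⊆ L²`, Mathlib's `ContinuousLinearMap.holderL`; compare the
  general `Literature.MathematicalPhysics.KineticTheory.FiniteRank.mulOp`, not imported to keep the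
  dependency cone number-theoretic), and the three conditions `IsSmoothSpectralTriple D :=
  IsSelfAdjoint D ∧ HasCompactResolvent D ∧ ∀ a ∈ 𝒜(λ), HasBoundedCommutator D a` (self-adjoint on
  `dom D₀`; `(D − i)⁻¹` exists and is compact; `a · dom D ⊆ dom D` and `‖[D, a]‖ < ∞`) [folklore
  unpacking of "spectral triple"]. The fact is stated for every finite-dimensional `U ≤ dom D₀`, which is
  exactly the generality of the printed proof.
* **Proposition 4.2** (p0013:L35): "For `E = 2πμ`, the number `N′(E)` of non-zero eigenvalues of
  `D(λ,k)` in `(0,E]` fulfills `N′(E) ∼ ⟨N(E)⟩`", `⟨N(E)⟩ = (E/2π) log(E/2π) − E/2π` (eq. (4.3),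
  p0013:L29), for `k` "smaller and close to the upper bound `ν(λ²)`". LABEL: HEURISTIC-IN-PRINT — the
  relation `∼` is at fixed `E = 2πμ` with `k ∼ 2μ` "up to a `log μ` term" (p0013:L37) and `ν(μ)`
  defined by "`χ(μ,m) ∼ 1`" (p0012:L5); it has no precise printed form and is therefore NOT typed as a
  named fact (cell rule: programme/heuristic sentences are not Literature facts). Typed and PROVED
  instead are its exact ingredients: the count of positive eigenvalues `2πj/L ≤ E` of `D₀`
  (`unperturbedPosCount L E = ⌊EL/2π⌋`, `unperturbedPosCount_eq_ncard`, `hasEigenvalue_diracD0_pos_iff`),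
  the displayed identity `EL/2π − μ = ⟨N(E)⟩` for `E = 2πμ`, `L = log μ` (p0013:L40–L43;
  `mainTerm_eq_smoothZeroCount`), and the paper's remark p0013:L19 ("the number of eigenvalues of
  `D(λ,k)` in `[0,E]` has the same asymptotic behavior as for `D₀(λ)`, and thus differs from the
  asymptotic behavior of the number `N(E)` of zeros", `N(E)` = eq. (4.2) = the tree's
  `Literature.NumberTheory.LFunctions.zetaZeroCount`) made rigorous for `D₀`: its count is `O(E)`
  (`isBigO_unperturbedPosCount`) hence eventually `< N_ζ(E)` by the tree's Riemann–von Mangoldt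
  comparison `Literature.Barriers.RiemannHypothesis.eventually_lt_zetaZeroCount_of_isBigO_holds`
  (`eventually_unperturbedPosCount_lt_zetaZeroCount`) — the same obstruction as the catalogued barrier
  `Literature.Barriers.RiemannHypothesis.BerryKeatingOperator` (ii).
* **Lemma 5.1** (p0016:L38) and **Proposition 5.2 (i), (ii)** (p0016:L52–p0017:L7) — the constrained
  Courant–Fischer max–min for the positive eigenvalues `μ_n(A)` (DEcreasing order) of a self-adjoint
  matrix with a subspace `E ⊆ ker A` excluded, the formula `μ_n(D_P) = max_{dim F = n, F ⊥ P} min_{ξ ∈ F,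
  ‖ξ‖=1} ⟨ξ∣Dξ⟩` for `D_P := QDQ`, `Q = 1 − P`, and the monotonicity `P₁ ≤ P₂ ⇒ μ_n(D_{P₂}) ≤ μ_n(D_{P₁})`
  — are PROVED in full (`eigenvalues_isGreatest_maxMin_of_le_ker`,
  `eigenvalues_complCompression_isGreatest_maxMin`, `eigenvalues_complCompression_anti`) for a symmetric
  operator on a finite-dimensional inner product space over `ℝ` or `ℂ` (the paper: `M_N(ℂ)`), from the
  tree's Courant–Fischer trial-subspace halves (`Literature.Analysis.InnerProduct.CourantFischerBounds`)
  and Mathlib's antitone enumeration `LinearMap.IsSymmetric.eigenvalues` (`μ_n = eigenvalues (n−1)`);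
  "projection (self-adjoint idempotent)" is Mathlib's `LinearMap.IsSymmetricProjection`, `P₁ ≤ P₂` the
  Loewner order, "`F ⊥ E`" is `F ≤ Eᗮ`, and "`max … min …`" is typed literally as
  `IsGreatest {m | ∃ F, dim F = n ∧ F ⊥ E ∧ IsLeast (Rayleigh values on the unit sphere of F) m} (μ_n)`.
  NOT typed as a fact: the inequality (5.2) `λ_n(D(λ,k+1)) ≤ λ_n(D(λ,k))` for the positive eigenvalues
  in INcreasing order of the unbounded operators, which the paper "explains" via Prop. 5.2 and displays
  numerically (p0016:L29–L37, p0017:L9) but does not state as a theorem.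
* §5.1 inline claim (p0016:L31–L36: graded index of `D₀` is `1`, stable under the finite-rank
  perturbation, hence `dim ker D(λ,k)` is odd; "for `k = 2ℓ` even it is natural to expect this kernel
  to be of dimension `k+1`"): NOT typed as a fact (inline index-theory remark plus an expectation); its
  ingredients `ker D₀ = ℂ·1` (even), (5.1) and `range Π ⊆ ker D` are the proved lemmas above.
* §5.3 (p0017:L11–L17): "the spectrum of `D₀(λ)` is characterized by the quantization condition
  `x^{iy} = 1`" (`x = μ = λ²`), "the union of the graphs of the functions `2πn/log x`". TYPED and PROVED:
  `IsQuantized x y := (x : ℂ)^{iy} = 1`, `isQuantized_iff` (`↔ ∃ n, y = 2πn/log x`) and, with `x = e^L`,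
  `isQuantized_exp_iff_hasEigenvalue` (`↔ y` is an eigenvalue of `D₀`). §5.4's criterion (common
  eigenvector of `D(λ,k)` and `D₀(λ)`) is the lemma `diracD_apply_of_mem_orthogonal`.

## Tree dictionary (cite, never restate)

`HilbertBasis.diagonalPMap / diagonalDomain / isSelfAdjoint_diagonalPMap_holds /
hasEigenvalue_diagonalPMap_iff / mem_eigenspace_diagonalPMap_iff` (UnboundedOperators prelude);
`LinearPMap.IsSymmetric / kernel / eigenspace / HasEigenvalue` (`SymmetricPMap`);
`Literature.Analysis.InnerProduct.exists_mem_re_inner_le_eigenvalues_mul`,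
`le_re_inner_apply_self_of_inner_eq_zero`, `finrank_headSpan`, `inner_eq_zero_of_mem_headSpan`
(Courant–Fischer); `Literature.NumberTheory.LFunctions.zetaZeroCount` (`N(E)`),
`Literature.Barriers.RiemannHypothesis.eventually_lt_zetaZeroCount_of_isBigO_holds`; Mathlib
`AddCircle`, `haarAddCircle`, `fourier`, `fourierLp`, `fourierBasis`, `hasDerivAt_fourier`,
`Lp.compMeasurePreservingₗᵢ`, `Submodule.starProjection`, `LinearMap.IsSymmetricProjection`,
`ContinuousLinearMap.holderL`. The §2 objects of this paper (basis `ξ_n`, `QW_λ`) live in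
`Literature/NumberTheory/LFunctions/WeilPolarTrigBasis.lean` and the `WeilSemilocal*`/`WeilWindow*` files
(real trigonometric basis on `[−L/2, L/2]`; here `e_j = fourier j`, `ξ_{±n} ∝ e_n ± e_{−n}`).

## WHAT THIS IS NOT

Not a positivity statement and not RH-bearing: the spectra of `D(λ,k)` are compared with zeta zeros only
numerically in print (§4.1–§4.2, §5), and by Thm. 6.4 (§6, typer t11) at special values of `λ`; no
claim about RH is typed here. Not a general theory of spectral triples (one explicit operator family on
one Hilbert space; no class, no instance, no notation). Not the §3 prolate projection (t9) and not the
§6 ζ-cycles (t11). Nothing here bears on the truth of RH.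

## References

* [ConnesConsani2023] A. Connes, C. Consani, *Spectral triples and ζ-cycles*, Enseign. Math. 69 (2023)
  93–148, doi:10.4171/lem/1049, arXiv:2106.01715: §3 Def. 3.1 (p0012:L26), §4 eq. (4.1)–(4.3),
  Prop. 4.1, Prop. 4.2 (p0013:L3–L43), §5 eq. (5.1)–(5.2), Lemma 5.1, Prop. 5.2 (p0016:L25–p0017:L9),
  §5.3–§5.4 (p0017:L11–L21).
* [HornJohnson2013] R. A. Horn, C. R. Johnson, *Matrix Analysis*, 2nd ed., Thm. 4.2.6 (Courant–Fischer)
  — via `Literature/Analysis/InnerProduct/CourantFischerBounds.lean`.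
* [ReedSimonI1980] M. Reed, B. Simon, *Methods of Modern Mathematical Physics I*, §VIII.3 Prop. 1
  (multiplication operators self-adjoint on the maximal domain) — via the UnboundedOperators prelude.
-/

noncomputable section

open MeasureTheory Complex Filter Asymptotics
open scoped InnerProductSpace ComplexConjugate ENNReal

namespace Literature.NumberTheory.ConnesConsani2023

namespace ZetaCycles

open _root_.AddCircle

/-! ### The circle `ℝ₊^*/λ^{2ℤ} ≅ ℝ/Lℤ`, `L = 2 log λ = log μ` -/

/-- The length `L = 2 log λ` of the circle `ℝ₊^*/λ^{2ℤ}` in the variable `x = log u` (§2, first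
paragraph: "the length `L = 2 log λ` of the support of the test functions"; §4 proof of Prop. 4.2:
"using `L = log μ`", `μ = λ²`). [cite: ConnesConsani2023, §2 ¶1 and §4 proof of Prop. 4.2 (arXiv chunk p0005:L3, p0013:L43)] -/
def periodLength (lam : ℝ) : ℝ := 2 * Real.log lam

/-- `L = 2 log λ = log μ` with `μ = λ²`. [cite: ConnesConsani2023, §4 proof of Prop. 4.2 (arXiv chunk p0013:L43)] -/
theorem periodLength_eq_log_sq (lam : ℝ) : periodLength lam = Real.log (lam ^ 2) := by
  rw [periodLength, Real.log_pow]; norm_num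

/-- `L > 0` for `λ > 1` (the circle `ℝ₊^*/λ^{2ℤ}` is non-degenerate). [cite: ConnesConsani2023, §2 ¶1 (arXiv chunk p0005:L3)] -/
theorem periodLength_pos {lam : ℝ} (h : 1 < lam) : 0 < periodLength lam :=
  mul_pos two_pos (Real.log_pos h)

/-- `ℋ(λ) = L²(ℝ₊^*/λ^{2ℤ}, d^*u) ≅ L²(ℝ/Lℤ)` (via `u = e^x`), realised as `Lp ℂ 2` of Mathlib's
`AddCircle L` with its Haar probability measure (Prop. 4.1 speaks of "periodic functions … in
`L²([−L/2, L/2])`"; the normalisation of the measure does not affect any statement below).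
[cite: ConnesConsani2023, §4 ¶1 (arXiv chunk p0013:L3)] -/
abbrev circleL2 (L : ℝ) [Fact (0 < L)] : Type := Lp ℂ 2 (@haarAddCircle L _)

variable {L : ℝ} [hL : Fact (0 < L)]

/-! ### `D₀(λ) = −iu∂_u = −i d/dx` -/

/-- The symbol `j ↦ 2πj/L` of `D₀ = −i d/dx` in the Fourier basis `e_j(x) = e^{2πijx/L}`
("the spectrum of `D₀(λ)` of `{2πk/L ∣ k ∈ ℤ}`"). [cite: ConnesConsani2023, §4 proof of Prop. 4.2 (arXiv chunk p0013:L37)] -/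
def diracSymbol (L : ℝ) (j : ℤ) : ℂ := ((2 * Real.pi * j / L : ℝ) : ℂ)

/-- The symbol is real. [folklore] -/
private theorem isSelfAdjoint_diracSymbol (L : ℝ) : IsSelfAdjoint (diracSymbol L) := by
  ext j
  simp [diracSymbol, Complex.conj_ofReal]

variable (L) in
/-- **`D₀(λ) := −iu∂_u`** (eq. (4.1)), i.e. `−i d/dx` on `L²(ℝ/Lℤ)`, realised as the maximal diagonal
operator with symbol `2πj/L` in Mathlib's Fourier Hilbert basis (`HilbertBasis.diagonalPMap` of the
tree's UnboundedOperators prelude): domain `{f | Σ_j |2πj/L|² |f̂(j)|² < ∞} = H¹(S¹_L)`, the natural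
self-adjointness domain of `−i d/dx`; on characters it IS `−i d/dx` (`diracD0_apply_fourierLp`,
`neg_I_mul_deriv_fourier`). [cite: ConnesConsani2023, §4 eq. (4.1) (arXiv chunk p0013:L6)] -/
def diracD0 : circleL2 L →ₗ.[ℂ] circleL2 L :=
  (fourierBasis (T := L)).diagonalPMap (diracSymbol L)

/-- The domain of `D₀` is the maximal diagonal (Sobolev) domain `{f | Σ |2πj/L|²|f̂(j)|² < ∞}`.
[cite: ConnesConsani2023, §4 ¶1 (arXiv chunk p0013:L9)] -/
theorem diracD0_domain : (diracD0 L).domain = (fourierBasis (T := L)).diagonalDomain (diracSymbol L) :=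
  rfl

/-- Characters lie in `dom D₀` ("the range of the prolate projection is contained in the domain of
`D₀(λ)`" uses exactly this for trigonometric polynomials). [cite: ConnesConsani2023, §4 ¶1 (arXiv chunk p0013:L9)] -/
theorem fourierLp_mem_diracD0_domain (j : ℤ) : fourierLp (T := L) 2 j ∈ (diracD0 L).domain := by
  have h := (fourierBasis (T := L)).basis_mem_diagonalDomain (diracSymbol L) j
  rwa [coe_fourierBasis] at h

/-- `D₀ e_j = (2πj/L) e_j`. [cite: ConnesConsani2023, §4 proof of Prop. 4.2 (arXiv chunk p0013:L37)] -/
theorem diracD0_apply_fourierLp (j : ℤ) :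
    diracD0 L ⟨fourierLp (T := L) 2 j, fourierLp_mem_diracD0_domain j⟩ =
      diracSymbol L j • fourierLp (T := L) 2 j := by
  have h := (fourierBasis (T := L)).diagonalPMap_apply_basis (diracSymbol L) j
  simp only [coe_fourierBasis] at h
  exact h

/-- Fourier coefficients of `D₀ f`: `(D₀ f)^(i) = (2πi/L) f̂(i)` (`−i d/dx` is diagonal in the
characters). [cite: ConnesConsani2023, §4 eq. (4.1) (arXiv chunk p0013:L6)] -/
theorem repr_diracD0_apply (f : (diracD0 L).domain) (i : ℤ) :
    (fourierBasis (T := L)).repr (diracD0 L f) i =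
      diracSymbol L i * (fourierBasis (T := L)).repr (f : circleL2 L) i :=
  (fourierBasis (T := L)).repr_diagonalPMap_apply (diracSymbol L) f i

/-- `D₀` is self-adjoint (the "standard Dirac operator" of the circle; Reed–Simon I §VIII.3 Prop. 1
via `HilbertBasis.isSelfAdjoint_diagonalPMap_holds`). [cite: ConnesConsani2023, §4 ¶1 (arXiv chunk p0013:L9)] -/
theorem isSelfAdjoint_diracD0 : IsSelfAdjoint (diracD0 L) :=
  (fourierBasis (T := L)).isSelfAdjoint_diagonalPMap_holds (isSelfAdjoint_diracSymbol L)

/-- `D₀` is symmetric. [cite: ConnesConsani2023, §4 ¶1 (arXiv chunk p0013:L9)] -/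
theorem isSymmetric_diracD0 : (diracD0 L).IsSymmetric :=
  (fourierBasis (T := L)).isSymmetric_diagonalPMap (isSelfAdjoint_diracSymbol L)

omit hL in
/-- `d/dx e_j = i (2πj/L) e_j` pointwise on `ℝ` (Mathlib's `hasDerivAt_fourier`), i.e.
`−iu∂_u e_j = (2πj/L) e_j`. [cite: ConnesConsani2023, §4 eq. (4.1) (arXiv chunk p0013:L6)] -/
theorem hasDerivAt_fourier_diracSymbol (j : ℤ) (x : ℝ) :
    HasDerivAt (fun y : ℝ => fourier j (y : AddCircle L))
      (I * (diracSymbol L j * fourier j (x : AddCircle L))) x := by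
  have h := hasDerivAt_fourier L j x
  convert h using 1
  simp only [diracSymbol]
  push_cast
  ring

omit hL in
/-- `−i (d/dx) e_j = (2πj/L) e_j`: the diagonal operator `diracD0` is `D₀ = −i∂_x = −iu∂_u`.
[cite: ConnesConsani2023, §4 eq. (4.1) (arXiv chunk p0013:L6)] -/
theorem neg_I_mul_deriv_fourier (j : ℤ) (x : ℝ) :
    -I * deriv (fun y : ℝ => fourier j (y : AddCircle L)) x =
      diracSymbol L j * fourier j (x : AddCircle L) := by
  rw [(hasDerivAt_fourier_diracSymbol j x).deriv, ← mul_assoc]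
  simp

/-- The symbol `j ↦ 2πj/L` is injective (`L > 0`): every eigenvalue of `D₀` is simple.
[cite: ConnesConsani2023, §4 proof of Prop. 4.2 (arXiv chunk p0013:L37)] -/
theorem diracSymbol_injective : Function.Injective (diracSymbol L) := by
  intro i j h
  have h1 : (2 * Real.pi * i / L : ℝ) = 2 * Real.pi * j / L := by
    exact_mod_cast Complex.ofReal_injective h
  have hL0 : (L : ℝ) ≠ 0 := hL.out.ne'
  have h2π : (2 * Real.pi : ℝ) ≠ 0 := by positivity
  rw [div_left_inj' hL0] at h1
  have h2 : (i : ℝ) = j := mul_left_cancel₀ h2π h1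
  exact_mod_cast h2

/-- The eigenvalues of `D₀(λ)` are exactly `{2πj/L : j ∈ ℤ}`. [cite: ConnesConsani2023, §4 proof of Prop. 4.2 (arXiv chunk p0013:L37)] -/
theorem hasEigenvalue_diracD0_iff {t : ℂ} :
    (diracD0 L).HasEigenvalue t ↔ ∃ j : ℤ, t = diracSymbol L j := by
  rw [diracD0, HilbertBasis.hasEigenvalue_diagonalPMap_iff, Set.mem_range]
  simp only [eq_comm]

/-- "The kernel of the operator `D₀(λ)` is one dimensional and given by the constant function `1_λ`":
`ker D₀ = ℂ · e_0`. [cite: ConnesConsani2023, §5.1 (arXiv chunk p0016:L33)] -/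
theorem mem_kernel_diracD0_iff {f : circleL2 L} :
    f ∈ (diracD0 L).kernel ↔ ∃ c : ℂ, f = c • fourierLp (T := L) 2 0 := by
  rw [LinearPMap.kernel, diracD0, HilbertBasis.mem_eigenspace_diagonalPMap_iff]
  constructor
  · intro h
    refine ⟨fourierBasis.repr f 0, ?_⟩
    have hsymb : ∀ i : ℤ, i ≠ 0 → diracSymbol L i ≠ 0 := by
      intro i hi h0
      apply hi
      apply diracSymbol_injective (L := L)
      rw [h0, diracSymbol]; simp
    have hrepr : fourierBasis.repr f =
        (fourierBasis.repr f 0) • lp.single (E := fun _ : ℤ => ℂ) 2 0 (1 : ℂ) := by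
      rw [← lp.single_smul, smul_eq_mul, mul_one]
      ext i
      by_cases hi : i = 0
      · subst hi; simp
      · rw [h i (hsymb i hi)]; simp [lp.single_apply, Pi.single_eq_of_ne hi]
    have := congr_arg (fourierBasis (T := L)).repr.symm hrepr
    rw [LinearIsometryEquiv.symm_apply_apply, LinearIsometryEquiv.map_smul,
      HilbertBasis.repr_symm_single, coe_fourierBasis] at this
    exact this
  · rintro ⟨c, rfl⟩ i hi
    have hi0 : i ≠ 0 := by rintro rfl; simp [diracSymbol] at hi
    rw [LinearIsometryEquiv.map_smul, ← coe_fourierBasis, HilbertBasis.repr_self]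
    simp [lp.single_apply, Pi.single_eq_of_ne hi0]

/-! ### The grading `γ` -/

variable (L) in
/-- **The grading `γ`**: `±1` on functions with `f(u⁻¹) = ±f(u)`, i.e. `(γf)(x) = f(−x)` on the circle
(`u = e^x`), as a linear isometry of `L²` (composition with the measure-preserving map `x ↦ −x`).
[cite: ConnesConsani2023, §3 after Def. 3.1 (arXiv chunk p0012:L28)] -/
def circleGrading : circleL2 L →ₗᵢ[ℂ] circleL2 L :=
  Lp.compMeasurePreservingₗᵢ ℂ (Neg.neg : AddCircle L → AddCircle L)
    (Measure.measurePreserving_neg (haarAddCircle (T := L)))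

/-- `(γ f)(x) = f(−x)` almost everywhere (`f(u⁻¹)` in the variable `u = e^x`).
[cite: ConnesConsani2023, §3 after Def. 3.1 (arXiv chunk p0012:L28)] -/
theorem coeFn_circleGrading (f : circleL2 L) :
    (circleGrading L f : AddCircle L → ℂ) =ᵐ[haarAddCircle] fun x => f (-x) :=
  Lp.coeFn_compMeasurePreserving f _

/-- `γ² = 1` ("the grading operator … which takes the values `±1`").
[cite: ConnesConsani2023, §3 after Def. 3.1 (arXiv chunk p0012:L28)] -/
theorem circleGrading_circleGrading (f : circleL2 L) :
    circleGrading L (circleGrading L f) = f := by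
  have hn := Measure.measurePreserving_neg (haarAddCircle (T := L))
  have h : (Neg.neg : AddCircle L → AddCircle L) ∘ Neg.neg = id := by
    funext x; simp
  change Lp.compMeasurePreserving Neg.neg hn (Lp.compMeasurePreserving Neg.neg hn f) = f
  rw [← Lp.compMeasurePreserving_comp_apply f hn hn]
  simp only [h]
  exact Lp.compMeasurePreserving_id_apply f

/-- `γ e_j = e_{−j}`. [cite: ConnesConsani2023, §3 after Def. 3.1 (arXiv chunk p0012:L28)] -/
theorem circleGrading_fourierLp (j : ℤ) :
    circleGrading L (fourierLp (T := L) 2 j) = fourierLp (T := L) 2 (-j) := by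
  have hn := Measure.measurePreserving_neg (haarAddCircle (T := L))
  apply Lp.ext
  have h1 := coeFn_circleGrading (L := L) (fourierLp (T := L) 2 j)
  have h2 : (fun x : AddCircle L => (fourierLp (T := L) 2 j : AddCircle L → ℂ) (-x))
      =ᵐ[haarAddCircle] fun x : AddCircle L => fourier j (-x) := by
    refine ae_eq_comp (μ := haarAddCircle (T := L)) hn.measurable.aemeasurable ?_
    rw [hn.map_eq]
    exact coeFn_fourierLp (T := L) 2 j
  have h3 := coeFn_fourierLp (T := L) 2 (-j)
  filter_upwards [h1, h2, h3] with x hx1 hx2 hx3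
  rw [hx1, hx2, hx3, fourier_apply, fourier_apply, smul_neg, ← neg_smul]

/-- `γ` is self-adjoint (a unitary involution, "takes the values `±1`").
[cite: ConnesConsani2023, §3 after Def. 3.1 (arXiv chunk p0012:L28)] -/
theorem inner_circleGrading_left (f g : circleL2 L) :
    ⟪circleGrading L f, g⟫_ℂ = ⟪f, circleGrading L g⟫_ℂ := by
  conv_lhs => rw [← circleGrading_circleGrading g]
  exact (circleGrading L).inner_map_map f (circleGrading L g)

/-- Fourier coefficients: `(γf)^(i) = f̂(−i)`. [cite: ConnesConsani2023, §3 after Def. 3.1 (arXiv chunk p0012:L28)] -/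
theorem repr_circleGrading (f : circleL2 L) (i : ℤ) :
    (fourierBasis (T := L)).repr (circleGrading L f) i =
      (fourierBasis (T := L)).repr f (-i) := by
  rw [HilbertBasis.repr_apply_apply, HilbertBasis.repr_apply_apply, coe_fourierBasis,
    ← inner_circleGrading_left, circleGrading_fourierLp]

omit hL in
/-- The symbol is odd: `2π(−i)/L = −2πi/L`. [folklore] -/
private theorem diracSymbol_neg (i : ℤ) : diracSymbol L (-i) = -diracSymbol L i := by
  simp [diracSymbol]; ring

/-- `γ` preserves `dom D₀` (so that (5.1) makes sense on the common domain).
[cite: ConnesConsani2023, §5.1 eq. (5.1) (arXiv chunk p0016:L29)] -/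
theorem circleGrading_mem_diracD0_domain {f : circleL2 L} (hf : f ∈ (diracD0 L).domain) :
    circleGrading L f ∈ (diracD0 L).domain := by
  rw [diracD0_domain, HilbertBasis.mem_diagonalDomain_iff] at hf ⊢
  have two : (0 : ℝ) < (2 : ℝ≥0∞).toReal := by norm_num
  rw [memℓp_gen_iff two] at hf ⊢
  have h : (fun i : ℤ => ‖diracSymbol L i * (fourierBasis (T := L)).repr (circleGrading L f) i‖
      ^ (2 : ℝ≥0∞).toReal) = (fun i : ℤ => ‖diracSymbol L i *
        (fourierBasis (T := L)).repr f i‖ ^ (2 : ℝ≥0∞).toReal) ∘ (Equiv.neg ℤ) := by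
    funext i
    simp only [Function.comp_apply, Equiv.neg_apply, repr_circleGrading, diracSymbol_neg,
      neg_mul, norm_neg]
  rw [h]
  exact (Equiv.neg ℤ).summable_iff.mpr hf

/-- `D₀ γ = −γ D₀` (the unperturbed case of eq. (5.1): `−i d/dx` is odd under `x ↦ −x`).
[cite: ConnesConsani2023, §5.1 eq. (5.1) (arXiv chunk p0016:L29)] -/
theorem diracD0_circleGrading (f : (diracD0 L).domain) :
    diracD0 L ⟨circleGrading L f, circleGrading_mem_diracD0_domain f.2⟩ =
      -circleGrading L (diracD0 L f) := by
  apply (fourierBasis (T := L)).repr.injective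
  ext i
  rw [repr_diracD0_apply, map_neg, lp.coeFn_neg, Pi.neg_apply, repr_circleGrading,
    repr_circleGrading, repr_diracD0_apply, diracSymbol_neg]
  ring

/-! ### The perturbed Dirac operator `D(λ,k) = (1 - Π) D₀ (1 - Π)` -/

section Perturbed

variable (U : Submodule ℂ (circleL2 L)) [FiniteDimensional ℂ U]

/-- `(1 − Π) f ∈ dom D₀` for `f ∈ dom D₀`, because `range Π ⊆ dom D₀`. [cite: ConnesConsani2023, §4 ¶1 (arXiv chunk p0013:L9)] -/
theorem sub_starProjection_mem_domain (hU : U ≤ (diracD0 L).domain) (f : (diracD0 L).domain) :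
    (f : circleL2 L) - U.starProjection f ∈ (diracD0 L).domain :=
  sub_mem f.2 (hU (U.starProjection_apply_mem _))

/-- `1 − Π(λ,k)` restricted to `dom D₀` (an endomorphism of the domain since `range Π ⊆ dom D₀`).
[cite: ConnesConsani2023, §4 eq. (4.1) (arXiv chunk p0013:L6–L9)] -/
def complProj (hU : U ≤ (diracD0 L).domain) : (diracD0 L).domain →ₗ[ℂ] (diracD0 L).domain where
  toFun f := ⟨(f : circleL2 L) - U.starProjection f, sub_starProjection_mem_domain U hU f⟩
  map_add' f g := by
    apply Subtype.ext
    simp only [Submodule.coe_add, map_add]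
    abel
  map_smul' c f := by
    apply Subtype.ext
    simp only [Submodule.coe_smul, map_smul, RingHom.id_apply, smul_sub]

/-- Unfolding: `complProj U hU f = f − Π f`. [cite: ConnesConsani2023, §4 eq. (4.1) (arXiv chunk p0013:L6)] -/
@[simp]
theorem coe_complProj (hU : U ≤ (diracD0 L).domain) (f : (diracD0 L).domain) :
    (complProj U hU f : circleL2 L) = (f : circleL2 L) - U.starProjection f := rfl

variable (L) in
/-- **`D(λ,k) := (1 − Π(λ,k)) ∘ D₀(λ) ∘ (1 − Π(λ,k))`** (eq. (4.1)) on `dom D₀`, where `Π = P_U` is the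
orthogonal projection on a finite-dimensional subspace `U ≤ dom D₀` — in print `U = span{ε_2,…,ε_{k+1}}`
(Def. 3.1, the prolate projection, typed by the §3 file; here a parameter). "This is a finite rank
perturbation of the standard Dirac operator `D₀(λ)`, since by construction the range of the prolate
projection `Π(λ,k)` is contained in the domain of `D₀(λ)`." [cite: ConnesConsani2023, §4 eq. (4.1) and Def. 3.1 (arXiv chunk p0013:L6, p0012:L26)] -/
def diracD (hU : U ≤ (diracD0 L).domain) : circleL2 L →ₗ.[ℂ] circleL2 L where
  domain := (diracD0 L).domain
  toFun := ((1 : circleL2 L →L[ℂ] circleL2 L) - U.starProjection).toLinearMap ∘ₗ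
    (diracD0 L).toFun ∘ₗ complProj U hU

/-- "The domain of `D(λ,k)` is the same as the domain of `D₀(λ)`." [cite: ConnesConsani2023, §4 proof of Prop. 4.1 (arXiv chunk p0013:L17)] -/
theorem diracD_domain (hU : U ≤ (diracD0 L).domain) :
    (diracD L U hU).domain = (diracD0 L).domain := rfl

/-- Unfolding: `D f = (1 − Π)(D₀ ((1 − Π) f))`. [cite: ConnesConsani2023, §4 eq. (4.1) (arXiv chunk p0013:L6)] -/
theorem diracD_apply (hU : U ≤ (diracD0 L).domain) (f : (diracD0 L).domain) :
    diracD L U hU f = diracD0 L (complProj U hU f) -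
      U.starProjection (diracD0 L (complProj U hU f)) := by
  rfl

/-- The displayed expansion `D(λ,k) = D₀(λ) − Π D₀ − D₀ Π + Π D₀ Π` on `dom D₀`.
[cite: ConnesConsani2023, §4 display after eq. (4.1) (arXiv chunk p0013:L12)] -/
theorem diracD_apply_eq_expand (hU : U ≤ (diracD0 L).domain) (f : (diracD0 L).domain) :
    diracD L U hU f = diracD0 L f - U.starProjection (diracD0 L f)
      - diracD0 L ⟨U.starProjection f, hU (U.starProjection_apply_mem _)⟩
      + U.starProjection (diracD0 L ⟨U.starProjection f, hU (U.starProjection_apply_mem _)⟩) := by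
  have hsplit : complProj U hU f = f - ⟨U.starProjection f, hU (U.starProjection_apply_mem _)⟩ := by
    ext; simp
  rw [diracD_apply, hsplit, LinearPMap.map_sub, map_sub]
  abel

/-- "By construction, the kernel of `D(λ,k)` contains the range of `Π(λ,k)`."
[cite: ConnesConsani2023, §5.1 (arXiv chunk p0016:L27)] -/
theorem le_kernel_diracD (hU : U ≤ (diracD0 L).domain) : U ≤ (diracD L U hU).kernel := by
  intro u hu
  rw [LinearPMap.mem_kernel_iff]
  refine ⟨hU hu, ?_⟩
  have h0 : complProj U hU ⟨u, hU hu⟩ = 0 := by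
    apply Subtype.ext
    simp [Submodule.starProjection_eq_self_iff.mpr hu]
  change diracD0 L (complProj U hU ⟨u, hU hu⟩) -
    U.starProjection (diracD0 L (complProj U hU ⟨u, hU hu⟩)) = 0
  rw [h0, LinearPMap.map_zero, map_zero, sub_zero]

/-- `D(λ,k)` is symmetric on `dom D₀` (the easy half of Prop. 4.1's self-adjointness). [cite: ConnesConsani2023, Prop. 4.1 (arXiv chunk p0013:L15)] -/
theorem isSymmetric_diracD (hU : U ≤ (diracD0 L).domain) : (diracD L U hU).IsSymmetric := by
  intro f g
  have hQ : ∀ x y : circleL2 L, ⟪x - U.starProjection x, y⟫_ℂ = ⟪x, y - U.starProjection y⟫_ℂ := by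
    intro x y
    rw [inner_sub_left, inner_sub_right, Submodule.inner_starProjection_left_eq_right]
  change ⟪diracD L U hU f, (g : circleL2 L)⟫_ℂ = ⟪(f : circleL2 L), diracD L U hU g⟫_ℂ
  rw [diracD_apply, diracD_apply, hQ, ← coe_complProj U hU g, isSymmetric_diracD0,
    coe_complProj, ← hQ]

/-- **Eq. (5.1)** `γ D(λ,k) = −D(λ,k) γ`, "by (3.3)" — here under the hypothesis (3.3)
`γ Π = Π γ`. [cite: ConnesConsani2023, §5.1 eq. (5.1) and eq. (3.3) (arXiv chunk p0016:L29, p0012:L31)] -/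
theorem diracD_circleGrading (hU : U ≤ (diracD0 L).domain)
    (hγ : ∀ f : circleL2 L, circleGrading L (U.starProjection f) = U.starProjection (circleGrading L f))
    (f : (diracD0 L).domain) :
    diracD L U hU ⟨circleGrading L f, circleGrading_mem_diracD0_domain f.2⟩ =
      -circleGrading L (diracD L U hU f) := by
  have h1 : complProj U hU ⟨circleGrading L f, circleGrading_mem_diracD0_domain f.2⟩ =
      ⟨circleGrading L (complProj U hU f),
        circleGrading_mem_diracD0_domain (complProj U hU f).2⟩ := by
    apply Subtype.ext
    simp [map_sub, hγ]
  change diracD0 L (complProj U hU ⟨circleGrading L f, circleGrading_mem_diracD0_domain f.2⟩) -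
      U.starProjection (diracD0 L (complProj U hU ⟨circleGrading L f,
        circleGrading_mem_diracD0_domain f.2⟩)) =
    -circleGrading L (diracD0 L (complProj U hU f) - U.starProjection (diracD0 L (complProj U hU f)))
  rw [h1, diracD0_circleGrading, map_sub, map_neg, ← hγ]
  abel

/-- The mechanism of §5.3–§5.4 ("the criterion of common eigenvector for `D(λ,k)` and `D₀(λ)`"): a
vector of `dom D₀` orthogonal to `range Π` on which `D₀` acts by `t` is an eigenvector of `D(λ,k)` with the
SAME eigenvalue `t` (so at the special `λ` where `e_j ⊥ range Π(λ,k)` the eigenvalue `2πj/log μ` of `D₀`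
is an eigenvalue of every `D(λ,k)`, independently of `k` — the quantization `μ^{iy} = 1` of §5.3).
[cite: ConnesConsani2023, §5.4 (arXiv chunk p0017:L19–L21)] -/
theorem diracD_apply_of_mem_orthogonal (hU : U ≤ (diracD0 L).domain) {f : (diracD0 L).domain}
    (hf : (f : circleL2 L) ∈ Uᗮ) {t : ℂ} (ht : diracD0 L f = t • (f : circleL2 L)) :
    diracD L U hU f = t • (f : circleL2 L) := by
  have hP : U.starProjection (f : circleL2 L) = 0 :=
    (Submodule.starProjection_apply_eq_zero_iff U).mpr hf
  have h1 : complProj U hU f = f := by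
    apply Subtype.ext
    simp [hP]
  rw [diracD_apply, h1, ht, map_smul, hP, smul_zero, sub_zero]

/-- From (5.1): if `D(λ,k) f = t f` then `D(λ,k)(γf) = −t (γf)` — "so that the number of eigenvalues of
`D(λ,k)` of absolute value less than `E` is `2N′(E)` plus the dimension of the kernel".
[cite: ConnesConsani2023, §4 proof of Prop. 4.2 (arXiv chunk p0013:L37)] -/
theorem diracD_circleGrading_of_eigen (hU : U ≤ (diracD0 L).domain)
    (hγ : ∀ f : circleL2 L, circleGrading L (U.starProjection f) = U.starProjection (circleGrading L f))
    {f : (diracD0 L).domain} {t : ℂ} (hf : diracD L U hU f = t • (f : circleL2 L)) :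
    diracD L U hU ⟨circleGrading L f, circleGrading_mem_diracD0_domain f.2⟩ =
      (-t) • circleGrading L (f : circleL2 L) := by
  rw [diracD_circleGrading U hU hγ, hf, map_smul, neg_smul]

/-- Sanity check (non-vacuity): with no prolate condition (`U = ⊥`, `Π = 0`) the "finite rank
perturbation" `D(λ,k)` is `D₀(λ)` itself. [cite: ConnesConsani2023, §4 ¶1 (arXiv chunk p0013:L9)] -/
theorem diracD_bot_apply (f : (diracD0 L).domain) :
    diracD L (⊥ : Submodule ℂ (circleL2 L)) bot_le f = diracD0 L f := by
  rw [diracD_apply]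
  have h : complProj (⊥ : Submodule ℂ (circleL2 L)) bot_le f = f := by
    apply Subtype.ext
    simp [Submodule.starProjection_bot]
  rw [h, Submodule.starProjection_bot]
  simp

end Perturbed

/-! ### The algebra `𝒜(λ) = C^∞(S¹_L)` and its action by multiplication -/

variable (L) in
/-- **`𝒜(λ) := C^∞(ℝ₊^*/λ^{2ℤ})`** = `C^∞(S¹_L)`: the subalgebra of `C(ℝ/Lℤ, ℂ)` of functions whose lift
to `ℝ` is `C^∞` (an explicit subalgebra; no instance). [cite: ConnesConsani2023, §4 ¶1 (arXiv chunk p0013:L3)] -/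
def smoothCircleAlgebra : Subalgebra ℂ C(AddCircle L, ℂ) where
  carrier := {a | ContDiff ℝ ((⊤ : ℕ∞) : WithTop ℕ∞) (fun x : ℝ => a (x : AddCircle L))}
  mul_mem' {a b} ha hb := by
    simp only [Set.mem_setOf_eq] at ha hb ⊢
    exact ha.mul hb
  add_mem' {a b} ha hb := by
    simp only [Set.mem_setOf_eq] at ha hb ⊢
    exact ha.add hb
  algebraMap_mem' c := by
    simp only [Set.mem_setOf_eq, Algebra.algebraMap_eq_smul_one, ContinuousMap.smul_apply,
      ContinuousMap.one_apply, smul_eq_mul, mul_one]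
    exact contDiff_const

omit hL in
/-- Membership in `𝒜(λ) = C^∞(S¹_L)` (by definition). [cite: ConnesConsani2023, §4 ¶1 (arXiv chunk p0013:L3)] -/
theorem mem_smoothCircleAlgebra_iff {a : C(AddCircle L, ℂ)} :
    a ∈ smoothCircleAlgebra L ↔
      ContDiff ℝ ((⊤ : ℕ∞) : WithTop ℕ∞) (fun x : ℝ => a (x : AddCircle L)) :=
  Iff.rfl

omit hL in
/-- The characters `e_n = e^{2πinx/L}` belong to `𝒜(λ) = C^∞(S¹_L)` (non-vacuity).
[cite: ConnesConsani2023, §4 ¶1 (arXiv chunk p0013:L3)] -/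
theorem fourier_mem_smoothCircleAlgebra (n : ℤ) : (fourier n : C(AddCircle L, ℂ)) ∈ smoothCircleAlgebra L := by
  rw [mem_smoothCircleAlgebra_iff]
  have h : (fun x : ℝ => (fourier n : C(AddCircle L, ℂ)) (x : AddCircle L)) =
      fun x : ℝ => Complex.exp (2 * Real.pi * I * n * x / L) := by
    funext x; exact fourier_coe_apply
  rw [h]
  apply ContDiff.cexp
  have : (fun x : ℝ => 2 * (Real.pi : ℂ) * I * n * x / L) =
      fun x : ℝ => (2 * (Real.pi : ℂ) * I * n / L) * (x : ℂ) := by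
    funext x; ring
  rw [this]
  exact contDiff_const.mul Complex.ofRealCLM.contDiff

/-- A continuous function on the (compact) circle is in `L^∞`. [folklore] -/
private theorem memLp_top_continuousMap (a : C(AddCircle L, ℂ)) :
    MemLp (a : AddCircle L → ℂ) ∞ (haarAddCircle (T := L)) :=
  memLp_top_of_bound a.continuous.aestronglyMeasurable ‖a‖
    (ae_of_all _ fun x => a.norm_coe_le_norm x)

/-- **The action of `𝒜(λ)` on `ℋ(λ)`** "by multiplication": `M_a g = a · g` for `a ∈ C(S¹_L)`, a bounded
operator on `L²` (Hölder `L^∞ · L² ⊆ L²`, Mathlib's `ContinuousLinearMap.holderL`; compare the general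
`Literature.MathematicalPhysics.KineticTheory.FiniteRank.mulOp`). [cite: ConnesConsani2023, §4 ¶1 and Prop. 4.1 (arXiv chunk p0013:L3, L15)] -/
def mulCLM (a : C(AddCircle L, ℂ)) : circleL2 L →L[ℂ] circleL2 L :=
  ((ContinuousLinearMap.mul ℂ ℂ).holderL (haarAddCircle (T := L)) (2 : ℝ≥0∞) (⊤ : ℝ≥0∞)
    (2 : ℝ≥0∞)).flip
    ((memLp_top_continuousMap a).toLp (a : AddCircle L → ℂ))

/-- `M_a g = a · g` almost everywhere ("the action of periodic functions by multiplication").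
[cite: ConnesConsani2023, Prop. 4.1 (arXiv chunk p0013:L15)] -/
theorem coeFn_mulCLM (a : C(AddCircle L, ℂ)) (g : circleL2 L) :
    (mulCLM a g : AddCircle L → ℂ) =ᵐ[haarAddCircle] fun x => a x * g x := by
  unfold mulCLM
  simp only [ContinuousLinearMap.flip_apply, ContinuousLinearMap.holderL_apply_apply]
  filter_upwards [(ContinuousLinearMap.mul ℂ ℂ).coeFn_holder (r := 2) g
      ((memLp_top_continuousMap a).toLp (a : AddCircle L → ℂ)),
    (memLp_top_continuousMap a).coeFn_toLp] with x hx ha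
  rw [hx, ContinuousLinearMap.mul_apply', ha, mul_comm]

/-- `e_m · e_n = e_{m+n}`: the character `e_m ∈ 𝒜(λ)` acts on the Fourier basis of `ℋ(λ)` as the
shift by `m` (non-vacuity of the action). [cite: ConnesConsani2023, Prop. 4.1 (arXiv chunk p0013:L15)] -/
theorem mulCLM_fourier_fourierLp (m n : ℤ) :
    mulCLM (fourier m : C(AddCircle L, ℂ)) (fourierLp (T := L) 2 n) = fourierLp (T := L) 2 (m + n) := by
  apply Lp.ext
  filter_upwards [coeFn_mulCLM (L := L) (fourier m) (fourierLp (T := L) 2 n),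
    coeFn_fourierLp (T := L) 2 n, coeFn_fourierLp (T := L) 2 (m + n)] with x h1 h2 h3
  rw [h1, h2, h3, fourier_add]

/-! ### Spectral-triple conditions for the pair `(𝒜(λ), ℋ(λ))` -/

/-- Spectral-triple condition "compact resolvent" for a partially defined operator `D` on `ℋ(λ)`:
`(D − i)⁻¹` exists as a bounded operator `R` (two-sided inverse of `D − i` between `dom D` and `ℋ`) and
is compact (one of the three conditions in "defines a spectral triple").
[cite: ConnesConsani2023, Prop. 4.1 (arXiv chunk p0013:L15)] -/
def HasCompactResolvent (D : circleL2 L →ₗ.[ℂ] circleL2 L) : Prop :=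
  ∃ R : circleL2 L →L[ℂ] circleL2 L, IsCompactOperator R ∧
    (∀ g : circleL2 L, ∃ h : R g ∈ D.domain, D ⟨R g, h⟩ - I • R g = g) ∧
    ∀ f : D.domain, R (D f - I • (f : circleL2 L)) = f

/-- Spectral-triple condition "bounded commutator" with `a`: multiplication by `a` preserves `dom D`
and `[D, a] = D M_a − M_a D` is bounded on `dom D` ("the boundedness of the commutator `[D(λ,k), f]`").
[cite: ConnesConsani2023, §4 proof of Prop. 4.1 (arXiv chunk p0013:L17)] -/
def HasBoundedCommutator (D : circleL2 L →ₗ.[ℂ] circleL2 L) (a : C(AddCircle L, ℂ)) : Prop :=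
  ∃ hdom : ∀ f : D.domain, mulCLM a f ∈ D.domain,
    ∃ C : ℝ, ∀ f : D.domain, ‖D ⟨mulCLM a f, hdom f⟩ - mulCLM a (D f)‖ ≤ C * ‖(f : circleL2 L)‖

/-- **`(𝒜(λ), ℋ(λ), D)` is a spectral triple**: `D` is self-adjoint (Mathlib's `IsSelfAdjoint` for
`LinearPMap`, `D† = D`), has compact resolvent, and has bounded commutators with every `a ∈ 𝒜(λ) =
C^∞(S¹_L)` acting by multiplication (the three defining conditions of a spectral triple, unpacked for this
one pair `(𝒜(λ), ℋ(λ))`; deliberately not a general structure).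
[cite: ConnesConsani2023, Prop. 4.1 (arXiv chunk p0013:L15)] -/
def IsSmoothSpectralTriple (D : circleL2 L →ₗ.[ℂ] circleL2 L) : Prop :=
  IsSelfAdjoint D ∧ HasCompactResolvent D ∧ ∀ a ∈ smoothCircleAlgebra L, HasBoundedCommutator D a

/-- NAMED FACT (RH-FREE; unproved in the tree) — **Proposition 4.1**: "The operator `D(λ,k)`, combined
with the action of periodic functions by multiplication in `L²([−L/2,L/2])` defines a spectral triple."
Printed proof: "`D(λ,k)` is a finite rank perturbation of `D₀(λ)`, thus by the Kato–Rellich theorem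
(see [Schmüdgen] Proposition 8.6) it is essentially self-adjoint on any core of `D₀(λ)`. The domain of
`D(λ,k)` is the same as the domain of `D₀(λ)` and the boundedness of the commutator `[D(λ,k),f]` follows
from the boundedness of the perturbation." Stated for every finite-dimensional `U ≤ dom D₀` in place of
the range of the prolate projection `Π(λ,k)` — exactly the generality the printed proof uses.
[cite: ConnesConsani2023, Prop. 4.1 (arXiv chunk p0013:L15–L17)] -/
def ConnesConsani2023_prop_4_1 : Prop :=
  ∀ (L : ℝ) [Fact (0 < L)] (U : Submodule ℂ (circleL2 L)) [FiniteDimensional ℂ U]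
    (hU : U ≤ (diracD0 L).domain), IsSmoothSpectralTriple (diracD L U hU)

/-! ### Prop 4.2: eigenvalue counts -/

/-- **`⟨N(E)⟩ = (E/2π) log(E/2π) − E/2π`** (eq. (4.3)), the smooth part of the zeta zero count
`N(E) = ⟨N(E)⟩ + N_osc(E)` (`N(E)` of eq. (4.2) is the tree's `Literature.NumberTheory.LFunctions.zetaZeroCount`;
compare `Literature.Barriers.RiemannHypothesis.rvmSmoothCount`, which carries the extra constant `7/8`).
[cite: ConnesConsani2023, §4 eq. (4.3) (arXiv chunk p0013:L29)] -/
def smoothZeroCount (E : ℝ) : ℝ :=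
  E / (2 * Real.pi) * Real.log (E / (2 * Real.pi)) - E / (2 * Real.pi)

/-- The number of positive eigenvalues `2πj/L ∈ (0, E]` of `D₀(λ)`, `#{j ≥ 1 : 2πj/L ≤ E} = ⌊EL/2π⌋`
(all simple, `diracSymbol_injective`): the unperturbed analogue of `N′(E)` and the term
`#({2πj/L} ∩ [−E,E]) = 2⌊EL/2π⌋ + 1` of the printed computation. [cite: ConnesConsani2023, §4 proof of Prop. 4.2 (arXiv chunk p0013:L37–L40)] -/
def unperturbedPosCount (L E : ℝ) : ℕ := ⌊E * L / (2 * Real.pi)⌋₊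

omit hL in
/-- `⌊EL/2π⌋` IS the number of indices `j ≥ 1` with `2πj/L ≤ E`. [cite: ConnesConsani2023, §4 proof of Prop. 4.2 (arXiv chunk p0013:L40)] -/
theorem unperturbedPosCount_eq_ncard (hL : 0 < L) (E : ℝ) :
    {j : ℤ | 0 < j ∧ (2 * Real.pi * j / L : ℝ) ≤ E}.ncard = unperturbedPosCount L E := by
  have h2π : (0 : ℝ) < 2 * Real.pi := by positivity
  have hset : {j : ℤ | 0 < j ∧ (2 * Real.pi * j / L : ℝ) ≤ E} =
      ↑(Finset.Icc (1 : ℤ) ⌊E * L / (2 * Real.pi)⌋) := by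
    ext j
    simp only [Set.mem_setOf_eq, Finset.coe_Icc, Set.mem_Icc, Int.le_floor]
    constructor
    · rintro ⟨h1, h2⟩
      refine ⟨by omega, ?_⟩
      rw [div_le_iff₀ hL] at h2
      rw [le_div_iff₀ h2π]
      linarith
    · rintro ⟨h1, h2⟩
      refine ⟨by omega, ?_⟩
      rw [div_le_iff₀ hL]
      rw [le_div_iff₀ h2π] at h2
      linarith
  rw [hset, Set.ncard_coe_finset, Int.card_Icc, unperturbedPosCount]
  rw [show ⌊E * L / (2 * Real.pi)⌋ + 1 - 1 = ⌊E * L / (2 * Real.pi)⌋ by ring, Int.floor_toNat]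

/-- The positive eigenvalues of `D₀(λ)` are the `2πj/L`, `j ≥ 1`. [cite: ConnesConsani2023, §4 proof of Prop. 4.2 (arXiv chunk p0013:L37)] -/
theorem hasEigenvalue_diracD0_pos_iff {t : ℝ} :
    ((diracD0 L).HasEigenvalue (t : ℂ) ∧ 0 < t) ↔ ∃ j : ℤ, 0 < j ∧ t = 2 * Real.pi * j / L := by
  rw [hasEigenvalue_diracD0_iff]
  constructor
  · rintro ⟨⟨j, hj⟩, ht⟩
    have hj' : t = 2 * Real.pi * j / L := by
      simp only [diracSymbol] at hj
      exact_mod_cast hj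
    refine ⟨j, ?_, hj'⟩
    rw [hj'] at ht
    have h1 : 0 < 2 * Real.pi * (j : ℝ) := by
      have := mul_pos ht hL.out
      rwa [div_mul_cancel₀ _ hL.out.ne'] at this
    have h2 : (0 : ℝ) < j := pos_of_mul_pos_right h1 (by positivity)
    exact_mod_cast h2
  · rintro ⟨j, hj, rfl⟩
    refine ⟨⟨j, by simp [diracSymbol]⟩, ?_⟩
    have : (0 : ℝ) < j := by exact_mod_cast hj
    have := hL.out
    positivity

/-- The displayed computation of the proof of **Proposition 4.2** (HEURISTIC-IN-PRINT as a whole, see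
the module docstring): with `E = 2πμ` and `L = log μ`, `EL/2π − μ = (E/2π) log(E/2π) − E/2π = ⟨N(E)⟩`
— exact algebra. [cite: ConnesConsani2023, Prop. 4.2 and its proof (arXiv chunk p0013:L35–L43)] -/
theorem mainTerm_eq_smoothZeroCount (μ : ℝ) :
    (2 * Real.pi * μ) * Real.log μ / (2 * Real.pi) - μ = smoothZeroCount (2 * Real.pi * μ) := by
  have h2π : (2 * Real.pi : ℝ) ≠ 0 := by positivity
  have h1 : 2 * Real.pi * μ / (2 * Real.pi) = μ := by field_simp
  rw [smoothZeroCount, h1, mul_comm (2 * Real.pi) μ, mul_assoc, mul_div_assoc,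
    mul_div_cancel_left₀ _ h2π]

omit hL in
/-- `⌊EL/2π⌋ ≤ EL/2π`. [folklore] -/
private theorem unperturbedPosCount_le (hL : 0 ≤ L) {E : ℝ} (hE : 0 ≤ E) :
    (unperturbedPosCount L E : ℝ) ≤ E * L / (2 * Real.pi) :=
  Nat.floor_le (by positivity)

omit hL in
/-- The eigenvalue count of `D₀(λ)` grows linearly: `⌊EL/2π⌋ = O(E)` ("the number of eigenvalues of
`D(λ,k)` in `[0,E]` has the same asymptotic behavior as for `D₀(λ)`"). [cite: ConnesConsani2023, §4 before eq. (4.2) (arXiv chunk p0013:L19)] -/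
theorem isBigO_unperturbedPosCount (L : ℝ) (hL : 0 ≤ L) :
    (fun E : ℝ => (unperturbedPosCount L E : ℝ)) =O[atTop] fun E : ℝ => E := by
  refine IsBigO.of_bound (L / (2 * Real.pi)) ?_
  filter_upwards [eventually_ge_atTop (0 : ℝ)] with E hE
  rw [Real.norm_of_nonneg (Nat.cast_nonneg _), Real.norm_of_nonneg hE]
  calc (unperturbedPosCount L E : ℝ) ≤ E * L / (2 * Real.pi) := unperturbedPosCount_le hL hE
    _ = L / (2 * Real.pi) * E := by ring

omit hL in
/-- "… and thus differs from the asymptotic behavior of the number `N(E)` of zeros of the Riemann zeta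
function": for every fixed `L`, the positive-eigenvalue count of `D₀(λ)` is eventually STRICTLY BELOW
`N_ζ(E)` (Riemann–von Mangoldt, via the tree's unconditional comparison
`Literature.Barriers.RiemannHypothesis.eventually_lt_zetaZeroCount_of_isBigO_holds` — the obstruction of the
catalogued barrier `BerryKeatingOperator` (ii)). RH-FREE. [cite: ConnesConsani2023, §4 before eq. (4.2) (arXiv chunk p0013:L19)] -/
theorem eventually_unperturbedPosCount_lt_zetaZeroCount (L : ℝ) (hL : 0 ≤ L) :
    ∀ᶠ E : ℝ in atTop, (unperturbedPosCount L E : ℝ) <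
      Literature.NumberTheory.LFunctions.zetaZeroCount E :=
  Literature.Barriers.RiemannHypothesis.eventually_lt_zetaZeroCount_of_isBigO_holds
    (isBigO_unperturbedPosCount L hL)

/-! ### §5.3 quantization `x^{iy} = 1` -/

/-! ### §5.3: the quantization condition `x^{iy} = 1` -/

/-- **Quantization condition** `x^{iy} = 1` for a point `(x, y)` of the plane (`x = μ = λ²`,
`y = λ_n(D(λ,k))`; complex power, principal branch). [cite: ConnesConsani2023, §5.3 (arXiv chunk p0017:L11–L15)] -/
def IsQuantized (x y : ℝ) : Prop := (x : ℂ) ^ (I * y) = 1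

omit hL in
/-- "The subset of the plane defined by this condition is the union of the graphs of the functions
`2πn/log x`": for `x > 0`, `x ≠ 1`, `x^{iy} = 1 ↔ ∃ n ∈ ℤ, y = 2πn/log x`. [cite: ConnesConsani2023, §5.3 (arXiv chunk p0017:L11)] -/
theorem isQuantized_iff {x : ℝ} (hx : 0 < x) (hx1 : x ≠ 1) (y : ℝ) :
    IsQuantized x y ↔ ∃ n : ℤ, y = 2 * Real.pi * n / Real.log x := by
  have hlog : Real.log x ≠ 0 := Real.log_ne_zero_of_pos_of_ne_one hx hx1
  have hx0 : (x : ℂ) ≠ 0 := by exact_mod_cast hx.ne'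
  have hlogC : (Real.log x : ℂ) ≠ 0 := by exact_mod_cast hlog
  rw [IsQuantized, cpow_def_of_ne_zero hx0, exp_eq_one_iff, ← ofReal_log hx.le]
  constructor
  · rintro ⟨n, hn⟩
    refine ⟨n, ?_⟩
    have h := congr_arg Complex.im hn
    have lhs : ((Real.log x : ℂ) * (I * (y : ℂ))).im = Real.log x * y := by
      simp [mul_im, mul_re]
    have rhs : ((n : ℂ) * (2 * (Real.pi : ℂ) * I)).im = 2 * Real.pi * n := by
      simp [mul_im, mul_re]; ring
    rw [lhs, rhs] at h
    rw [eq_div_iff hlog]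
    linarith
  · rintro ⟨n, rfl⟩
    refine ⟨n, ?_⟩
    have h : (Real.log x : ℂ) * (((2 * Real.pi * n / Real.log x : ℝ)) : ℂ) = 2 * Real.pi * n := by
      push_cast
      field_simp
    calc (Real.log x : ℂ) * (I * (((2 * Real.pi * n / Real.log x : ℝ)) : ℂ))
        = I * ((Real.log x : ℂ) * (((2 * Real.pi * n / Real.log x : ℝ)) : ℂ)) := by ring
      _ = n * (2 * Real.pi * I) := by rw [h]; ring

/-- "In terms of the coordinates `(x,y)` where `x = μ = λ²` … the spectrum of `D₀(λ)` is characterized by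
the quantization condition `x^{iy} = 1`": with `x = e^L` (`L = log μ`), `y` is quantized iff `y` is an
eigenvalue of `D₀(λ)`. [cite: ConnesConsani2023, §5.3 (arXiv chunk p0017:L11)] -/
theorem isQuantized_exp_iff_hasEigenvalue (y : ℝ) :
    IsQuantized (Real.exp L) y ↔ (diracD0 L).HasEigenvalue (y : ℂ) := by
  have hx1 : Real.exp L ≠ 1 := by
    rw [Ne, Real.exp_eq_one_iff]; exact hL.out.ne'
  rw [isQuantized_iff (Real.exp_pos L) hx1, Real.log_exp, hasEigenvalue_diracD0_iff]
  simp only [diracSymbol]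
  constructor
  · rintro ⟨n, rfl⟩; exact ⟨n, by push_cast; ring⟩
  · rintro ⟨n, hn⟩; exact ⟨n, by exact_mod_cast hn⟩

/-! ### §5: Lemma 5.1 and Proposition 5.2 (finite-dimensional min–max with a kernel constraint) -/

section MinMax

open Module _root_.Literature.Analysis.InnerProduct

variable {𝕜 : Type*} [RCLike 𝕜] {E : Type*} [NormedAddCommGroup E] [InnerProductSpace 𝕜 E]
  {n : ℕ}

omit hL

/-- Rayleigh scaling `re ⟪T(cx), cx⟫ = |c|² re ⟪Tx, x⟫`. [folklore] -/
private theorem re_inner_apply_smul_self (T : E →ₗ[𝕜] E) (c : 𝕜) (x : E) :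
    RCLike.re ⟪T (c • x), c • x⟫_𝕜 = ‖c‖ ^ 2 * RCLike.re ⟪T x, x⟫_𝕜 := by
  rw [map_smul, inner_smul_left, inner_smul_right, ← mul_assoc, RCLike.conj_mul,
    ← RCLike.ofReal_pow, RCLike.re_ofReal_mul]

/-- A lower bound `m` for the Rayleigh values on the unit sphere of `F` gives `m‖x‖² ≤ re ⟪Tx, x⟫` on
`F`. [folklore] -/
private theorem mul_norm_sq_le_re_inner_of_unit {T : E →ₗ[𝕜] E} {F : Submodule 𝕜 E} {m : ℝ}
    (h : ∀ ξ : E, ξ ∈ F → ‖ξ‖ = 1 → m ≤ RCLike.re ⟪T ξ, ξ⟫_𝕜) {x : E} (hx : x ∈ F) (hx0 : x ≠ 0) :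
    m * ‖x‖ ^ 2 ≤ RCLike.re ⟪T x, x⟫_𝕜 := by
  have hnx : 0 < ‖x‖ := norm_pos_iff.mpr hx0
  have hunit : ‖((‖x‖⁻¹ : ℝ) : 𝕜) • x‖ = 1 := by
    rw [norm_smul, RCLike.norm_ofReal, abs_of_pos (inv_pos.mpr hnx), inv_mul_cancel₀ hnx.ne']
  have hmem : ((‖x‖⁻¹ : ℝ) : 𝕜) • x ∈ F := F.smul_mem _ hx
  have h1 := h _ hmem hunit
  rw [re_inner_apply_smul_self, RCLike.norm_ofReal, abs_of_pos (inv_pos.mpr hnx)] at h1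
  have h2 : m * ‖x‖ ^ 2 ≤ ‖x‖⁻¹ ^ 2 * RCLike.re ⟪T x, x⟫_𝕜 * ‖x‖ ^ 2 :=
    mul_le_mul_of_nonneg_right h1 (sq_nonneg _)
  calc m * ‖x‖ ^ 2 ≤ ‖x‖⁻¹ ^ 2 * RCLike.re ⟪T x, x⟫_𝕜 * ‖x‖ ^ 2 := h2
    _ = RCLike.re ⟪T x, x⟫_𝕜 := by field_simp

/-- **`D_P := Q D Q`, `Q = 1 − P`** (Prop. 5.2 (i)): the two-sided compression of `D` by the
complementary projection, as an operator on the whole space (compare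
`Literature.NumberTheory.ConnesConsani.compression`, which is `P_K T|_K` on `K`). [cite: ConnesConsani2023, Prop. 5.2 (i) (arXiv chunk p0016:L52)] -/
def complCompression (D P : E →ₗ[𝕜] E) : E →ₗ[𝕜] E := (1 - P) ∘ₗ D ∘ₗ (1 - P)

/-- Unfolding: `D_P x = Q D Q x = D(x − Px) − P(D(x − Px))`. [cite: ConnesConsani2023, Prop. 5.2 (i) (arXiv chunk p0016:L52)] -/
theorem complCompression_apply (D P : E →ₗ[𝕜] E) (x : E) :
    complCompression D P x = D (x - P x) - P (D (x - P x)) := by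
  simp [complCompression]

/-- `D_P = QDQ` is symmetric (self-adjoint) for self-adjoint `D` and a projection `P`, so that its
eigenvalues `μ_n(D_P)` make sense. [cite: ConnesConsani2023, Prop. 5.2 (i) (arXiv chunk p0016:L52)] -/
theorem isSymmetric_complCompression {D P : E →ₗ[𝕜] E} (hD : D.IsSymmetric)
    (hP : P.IsSymmetricProjection) : (complCompression D P).IsSymmetric := by
  have hQ : ((1 : E →ₗ[𝕜] E) - P).IsSymmetric := LinearMap.IsSymmetric.id.sub hP.isSymmetric
  intro x y
  simp only [complCompression, LinearMap.coe_comp, Function.comp_apply]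
  rw [hQ, hD, hQ]

/-- `range P ⊆ ker D_P` ("By (5.3) applied for `A = D_P` and `E = P(ℂ^N)`" uses `P(ℂ^N) ⊆ Ker D_P`).
[cite: ConnesConsani2023, proof of Prop. 5.2 (i) (arXiv chunk p0016:L66)] -/
theorem range_le_ker_complCompression (D : E →ₗ[𝕜] E) {P : E →ₗ[𝕜] E}
    (hP : P.IsSymmetricProjection) : LinearMap.range P ≤ LinearMap.ker (complCompression D P) := by
  rintro _ ⟨x, rfl⟩
  rw [LinearMap.mem_ker, complCompression_apply]
  have : P (P x) = P x := by
    have := hP.isIdempotentElem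
    rw [IsIdempotentElem] at this
    exact congr_fun (congr_arg DFunLike.coe this) x |>.symm ▸ rfl
  simp [this]

/-- "for `ξ ⊥ E` one has `Qξ = ξ` so that `⟨ξ∣D_Pξ⟩ = ⟨ξ∣QDQξ⟩ = ⟨Qξ∣DQξ⟩ = ⟨ξ∣Dξ⟩`".
[cite: ConnesConsani2023, proof of Prop. 5.2 (i) (arXiv chunk p0017:L1–L5)] -/
theorem inner_complCompression_of_mem_orthogonal {D P : E →ₗ[𝕜] E} (hP : P.IsSymmetricProjection)
    {ξ : E} (hξ : ξ ∈ (LinearMap.range P)ᗮ) : ⟪ξ, complCompression D P ξ⟫_𝕜 = ⟪ξ, D ξ⟫_𝕜 := by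
  have hker : (LinearMap.range P)ᗮ = LinearMap.ker P :=
    (LinearMap.IsIdempotentElem.isSymmetric_iff_orthogonal_range hP.isIdempotentElem).mp
      hP.isSymmetric
  have hPξ : P ξ = 0 := by rw [hker] at hξ; exact hξ
  rw [complCompression_apply, hPξ, sub_zero, inner_sub_right, ← hP.isSymmetric, hPξ, inner_zero_left,
    sub_zero]

/-- Real-part form of `⟨ξ∣D_Pξ⟩ = ⟨ξ∣Dξ⟩` for `ξ ⊥ P`. [cite: ConnesConsani2023, proof of Prop. 5.2 (i) (arXiv chunk p0017:L1–L5)] -/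
theorem re_inner_complCompression_self_of_mem_orthogonal {D P : E →ₗ[𝕜] E}
    (hP : P.IsSymmetricProjection) {ξ : E} (hξ : ξ ∈ (LinearMap.range P)ᗮ) :
    RCLike.re ⟪complCompression D P ξ, ξ⟫_𝕜 = RCLike.re ⟪ξ, D ξ⟫_𝕜 := by
  rw [← inner_complCompression_of_mem_orthogonal hP hξ, ← inner_conj_symm, RCLike.conj_re]

variable [FiniteDimensional 𝕜 E]

/-- Eigenvectors of a symmetric operator for a non-zero eigenvalue are orthogonal to its kernel ("all
these eigenvectors are orthogonal to the kernel of `A` since `μ_k(A) ≥ μ_n(A) > 0`").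
[cite: ConnesConsani2023, proof of Lemma 5.1 (arXiv chunk p0016:L50)] -/
theorem inner_eigenvectorBasis_eq_zero_of_mem_ker {A : E →ₗ[𝕜] E} (hA : A.IsSymmetric)
    (hn : finrank 𝕜 E = n) (i : Fin n) (hi : hA.eigenvalues hn i ≠ 0) {w : E}
    (hw : w ∈ LinearMap.ker A) : ⟪w, hA.eigenvectorBasis hn i⟫_𝕜 = 0 := by
  have h1 : ⟪w, A (hA.eigenvectorBasis hn i)⟫_𝕜 = 0 := by
    rw [← hA, LinearMap.mem_ker.mp hw, inner_zero_left]
  rw [hA.apply_eigenvectorBasis, inner_smul_right] at h1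
  rcases mul_eq_zero.mp h1 with h | h
  · exact absurd (by exact_mod_cast h : hA.eigenvalues hn i = 0) hi
  · exact h

/-- **Lemma 5.1.** "Let `A` be a self-adjoint matrix of dimension `N`, and `E ⊂ Ker A` a subspace of its
kernel. Then the positive eigenvalues `μ_n(A)` arranged in decreasing order fulfill
`μ_n(A) = max_{F ∣ dim F = n, F ⊥ E} min_{ξ ∈ F, ‖ξ‖ = 1} ⟨ξ ∣ Aξ⟩`" (eq. (5.3)). Typed with Mathlib's
antitone enumeration (`μ_n = eigenvalues (n − 1)`, so `dim F = k + 1` for the index `k : Fin N`), the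
kernel subspace called `W`, `F ⊥ W` as `F ≤ Wᗮ`, and `max/min` as `IsGreatest/IsLeast` (both extrema are
attained: at `F = span{b₀,…,b_k}` and `ξ = b_k`). PROVED from the tree's Courant–Fischer halves, as in
print ("It can only lower it … this `F` is the linear span of the eigenvectors for eigenvalues `μ_k(A)`,
`k ≤ n`, and all these eigenvectors are orthogonal to the kernel of `A`"); over `ℝ` or `ℂ`. The
Rayleigh value is typed `re ⟪ξ, Aξ⟫` (`⟪ξ, Aξ⟫` is real for symmetric `A`; `⟨·∣·⟩` antilinear in the
first variable as in Mathlib). [cite: ConnesConsani2023, Lemma 5.1 eq. (5.3) (arXiv chunk p0016:L38–L50)] -/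
theorem eigenvalues_isGreatest_maxMin_of_le_ker {A : E →ₗ[𝕜] E} (hA : A.IsSymmetric) (hn : finrank 𝕜 E = n)
    (W : Submodule 𝕜 E) (hW : W ≤ LinearMap.ker A) (k : Fin n)
    (hk : 0 < hA.eigenvalues hn k) :
    IsGreatest {m : ℝ | ∃ F : Submodule 𝕜 E, finrank 𝕜 F = k + 1 ∧ F ≤ Wᗮ ∧
        IsLeast ((fun ξ : E => RCLike.re ⟪ξ, A ξ⟫_𝕜) '' {ξ : E | ξ ∈ F ∧ ‖ξ‖ = 1}) m}
      (hA.eigenvalues hn k) := by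
  have hsymm : ∀ ξ : E, RCLike.re ⟪ξ, A ξ⟫_𝕜 = RCLike.re ⟪A ξ, ξ⟫_𝕜 := fun ξ => by rw [hA]
  constructor
  · -- the span of the top `k + 1` eigenvectors realises the maximum
    set F : Submodule 𝕜 E :=
      Submodule.span 𝕜 (Set.range fun j : {j : Fin n // j ≤ k} => hA.eigenvectorBasis hn j) with hF
    refine ⟨F, finrank_headSpan hA hn k, ?_, ?_, ?_⟩
    · -- `F ⊥ W`: eigenvectors with eigenvalue `λ_j ≥ λ_k > 0` are orthogonal to `ker A ⊇ W`
      rw [hF, Submodule.span_le]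
      rintro _ ⟨j, rfl⟩
      rw [SetLike.mem_coe, Submodule.mem_orthogonal]
      intro w hwW
      exact inner_eigenvectorBasis_eq_zero_of_mem_ker hA hn j
        (ne_of_gt (lt_of_lt_of_le hk (hA.eigenvalues_antitone hn j.2))) (hW hwW)
    · -- `λ_k` is attained at `b_k`
      refine ⟨hA.eigenvectorBasis hn k, ⟨?_, (hA.eigenvectorBasis hn).orthonormal.1 k⟩, ?_⟩
      · exact Submodule.subset_span ⟨⟨k, le_rfl⟩, rfl⟩
      · simp only [hA.apply_eigenvectorBasis, inner_smul_right, inner_self_eq_norm_sq_to_K,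
          (hA.eigenvectorBasis hn).orthonormal.1 k]
        simp
    · -- `λ_k` is a lower bound on the unit sphere of `F`
      rintro _ ⟨ξ, ⟨hξF, hξ1⟩, rfl⟩
      simp only [hsymm]
      have h := le_re_inner_apply_self_of_inner_eq_zero hA hn k
        (fun i hi => inner_eq_zero_of_mem_headSpan hA hn k hξF i hi)
      rwa [hξ1, one_pow, mul_one] at h
  · -- no admissible `F` does better
    rintro m ⟨F, hFdim, -, hleast⟩
    obtain ⟨x, hxF, hx0, hle⟩ := exists_mem_re_inner_le_eigenvalues_mul hA hn k F (by omega)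
    have hlow : ∀ ξ : E, ξ ∈ F → ‖ξ‖ = 1 → m ≤ RCLike.re ⟪A ξ, ξ⟫_𝕜 := by
      intro ξ hξF hξ1
      rw [← hsymm]
      exact hleast.2 ⟨ξ, ⟨hξF, hξ1⟩, rfl⟩
    have h1 := mul_norm_sq_le_re_inner_of_unit hlow hxF hx0
    have hx2 : 0 < ‖x‖ ^ 2 := by positivity
    exact le_of_mul_le_mul_right (h1.trans hle) hx2

/-- **Proposition 5.2 (i).** "Let `D ∈ M_N(ℂ)` be a self-adjoint matrix. Let `P ∈ M_N(ℂ)` be a projection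
(self-adjoint idempotent) and `Q = 1 − P`, `D_P := QDQ`. Then the positive eigenvalues of `D_P` arranged
in decreasing order fulfill the equality `μ_n(D_P) = max_{F ∣ dim F = n, F ⊥ P} min_{ξ ∈ F, ‖ξ‖ = 1}
⟨ξ ∣ Dξ⟩`" (eq. (5.4); note `D`, not `D_P`, inside). "Projection" is Mathlib's
`LinearMap.IsSymmetricProjection`, `F ⊥ P` is `F ≤ (range P)ᗮ`; conventions as in Lemma 5.1. PROVED as
in print from Lemma 5.1 with `A = D_P`, `E = P(ℂ^N)`. [cite: ConnesConsani2023, Prop. 5.2 (i) eq. (5.4) (arXiv chunk p0016:L52–L60, p0016:L64–p0017:L5)] -/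
theorem eigenvalues_complCompression_isGreatest_maxMin {D P : E →ₗ[𝕜] E} (hD : D.IsSymmetric)
    (hP : P.IsSymmetricProjection) (hn : finrank 𝕜 E = n) (k : Fin n)
    (hk : 0 < (isSymmetric_complCompression hD hP).eigenvalues hn k) :
    IsGreatest {m : ℝ | ∃ F : Submodule 𝕜 E, finrank 𝕜 F = k + 1 ∧ F ≤ (LinearMap.range P)ᗮ ∧
        IsLeast ((fun ξ : E => RCLike.re ⟪ξ, D ξ⟫_𝕜) '' {ξ : E | ξ ∈ F ∧ ‖ξ‖ = 1}) m}
      ((isSymmetric_complCompression hD hP).eigenvalues hn k) := by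
  have h := eigenvalues_isGreatest_maxMin_of_le_ker (isSymmetric_complCompression hD hP) hn
    (LinearMap.range P) (range_le_ker_complCompression D hP) k hk
  have hset : {m : ℝ | ∃ F : Submodule 𝕜 E, finrank 𝕜 F = k + 1 ∧ F ≤ (LinearMap.range P)ᗮ ∧
        IsLeast ((fun ξ : E => RCLike.re ⟪ξ, D ξ⟫_𝕜) '' {ξ : E | ξ ∈ F ∧ ‖ξ‖ = 1}) m} =
      {m : ℝ | ∃ F : Submodule 𝕜 E, finrank 𝕜 F = k + 1 ∧ F ≤ (LinearMap.range P)ᗮ ∧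
        IsLeast ((fun ξ : E => RCLike.re ⟪ξ, complCompression D P ξ⟫_𝕜) ''
          {ξ : E | ξ ∈ F ∧ ‖ξ‖ = 1}) m} := by
    ext m
    refine exists_congr fun F => and_congr_right fun _ => and_congr_right fun hF => ?_
    have heq : Set.EqOn (fun ξ : E => RCLike.re ⟪ξ, D ξ⟫_𝕜)
        (fun ξ : E => RCLike.re ⟪ξ, complCompression D P ξ⟫_𝕜) {ξ : E | ξ ∈ F ∧ ‖ξ‖ = 1} := by
      intro ξ hξ
      simp only [inner_complCompression_of_mem_orthogonal hP (hF hξ.1)]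
    rw [heq.image_eq]
  rw [hset]
  exact h

/-- **Proposition 5.2 (ii).** "Let `P_j ∈ M_N(ℂ)` be projections such that `P₁ ≤ P₂`. Then, with the
notations of (i) the positive eigenvalues of `D_{P_j}` fulfill the inequality `μ_n(D_{P₂}) ≤ μ_n(D_{P₁})`"
(eq. (5.5); `P₁ ≤ P₂` in the Loewner order, equivalently `range P₁ ≤ range P₂`). PROVED as in print:
"We apply (5.4) to `μ_n(D_{P_j})`. The condition `F ⊥ P₂` is more restrictive than `F ⊥ P₁`." This is the
rigorous finite-dimensional content behind the expected inequality (5.2)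
`λ_n(D(λ,k+1)) ≤ λ_n(D(λ,k))` (`Π(λ,k) < Π(λ,k+1)`). [cite: ConnesConsani2023, Prop. 5.2 (ii) eq. (5.5) (arXiv chunk p0016:L62–L64, p0017:L7)] -/
theorem eigenvalues_complCompression_anti {D P₁ P₂ : E →ₗ[𝕜] E} (hD : D.IsSymmetric)
    (hP₁ : P₁.IsSymmetricProjection) (hP₂ : P₂.IsSymmetricProjection) (h12 : P₁ ≤ P₂)
    (hn : finrank 𝕜 E = n) (k : Fin n)
    (hk : 0 < (isSymmetric_complCompression hD hP₂).eigenvalues hn k) :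
    (isSymmetric_complCompression hD hP₂).eigenvalues hn k ≤
      (isSymmetric_complCompression hD hP₁).eigenvalues hn k := by
  obtain ⟨F, hFdim, hFP₂, hleast⟩ :=
    (eigenvalues_complCompression_isGreatest_maxMin hD hP₂ hn k hk).1
  have hrange : LinearMap.range P₁ ≤ LinearMap.range P₂ :=
    (hP₁.le_iff_range_le_range hP₂).mp h12
  have hFP₁ : F ≤ (LinearMap.range P₁)ᗮ := hFP₂.trans (Submodule.orthogonal_le hrange)
  -- lower bound `μ_k(D_{P₂}) ‖x‖² ≤ re ⟪D_{P₁} x, x⟫` on `F`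
  have hlow : ∀ ξ : E, ξ ∈ F → ‖ξ‖ = 1 →
      (isSymmetric_complCompression hD hP₂).eigenvalues hn k ≤
        RCLike.re ⟪complCompression D P₁ ξ, ξ⟫_𝕜 := by
    intro ξ hξF hξ1
    rw [re_inner_complCompression_self_of_mem_orthogonal hP₁ (hFP₁ hξF)]
    exact hleast.2 ⟨ξ, ⟨hξF, hξ1⟩, rfl⟩
  obtain ⟨x, hxF, hx0, hle⟩ := exists_mem_re_inner_le_eigenvalues_mul
    (isSymmetric_complCompression hD hP₁) hn k F (by omega)
  have h1 := mul_norm_sq_le_re_inner_of_unit hlow hxF hx0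
  have hx2 : 0 < ‖x‖ ^ 2 := by positivity
  exact le_of_mul_le_mul_right (h1.trans hle) hx2

end MinMax

end ZetaCycles

end Literature.NumberTheory.ConnesConsani2023
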